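import Summits.CriticalPhenomena.Ising3DConformalLimit.Theorems.FKParityRobustnessStrandShadowOddCutDefs
import Summits.CriticalPhenomena.Ising3DConformalLimit.Theorems.FKParityRobustnessStrandShadowOddClusterCutFibre
import Summits.CriticalPhenomena.Ising3DConformalLimit.Theorems.FKParityRobustnessStrandShadowOddClusterCutSwitching
import Summits.CriticalPhenomena.Ising3DConformalLimit.Theorems.FKParityRobustnessStrandShadowTraceDictionary
import Summits.CriticalPhenomena.Ising3DConformalLimit.Theorems.StrandShadow.Negative.PairSplitDeletion
import HarnessLib

/-!
# Route `FKParityRobustness`, crux `StrandShadow` (stmt-CriticalPhenomena-14626), line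
# `odd-cluster-cut-exact-helper`: the first-moment identity `stub_oddClusterCutFirstMoment`

File 3/3 (assembly).  For a finite graph `G`, `β ≥ 0`, `t = tanh β`, four marked vertices
`a : Fin 4 → V` and a pairing odd-cluster pair `KK = (K, K′) ∈ pairIdx G a` (vocabulary of
`FKParityRobustnessStrandShadowOddCutDefs.lean`: fibre, holed volume `H`, attaching pairs,
`cfg`, `cfgWeight`, `fibreMass = W`, `bridges`, `bridgeMoment = M_n`, `firstMom`):

  `M₁(K,K′) = W(K,K′) · t⁴ Σ_{((k,u),(k′,v)) attaching} ⟨σ_uσ_v⟩^free_H ⟨σ_uσ_v⟩^free_G`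

(`stub_oddClusterCutFirstMoment`, from the closed nested switching identity
`oddCutFM_nestedSwitchingClosed` = `oddCutFM_nestedSwitchingTJoin` (file 2/3) applied to the
two-current trace dictionary `twoCurrentTraceDictionary` (`…StrandShadowTraceDictionary.lean`);
`oddCutFM_of_switching` is the switching-free implication).  Proof, pair by pair (`oddCutFM_pair`):
1. `(K, K′)` are vertex-disjoint members of the cluster index sets at `a₀` resp. `a₂`
   (`clusterEdges_mem_clusterIndex`, `rch_a1` of `PairSplitDeletion.lean`), so by the TWO-CLUSTER
   FIBRE BIJECTION (`oddCutFM_twoCluster_sum`, file 1/3) the fibre is `{K ⊔ K′ ⊔ R}`, `R` an even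
   subgraph of the holed graph `G₁` (edges of `G` inside `H`), and `W = t^{|K|+|K′|} Z∅(E₁) Z∅(G)`;
2. the medium `(F ∪ F′ ∪ η)|_H` equals `R ∪ F′|_{E₁} ∪ η|_{E₁}`; the two attaching bonds are distinct
   edges of `G` outside `E₁`, so the Bernoulli(`t²`) product weight of `η` factorises over
   `E₁ ⊔ (E ∖ E₁)` and the two sprinkles cost exactly `t⁴` (`oddCutFM_eta_sum`, file 1/3);
3. the remaining triple sum is the NESTED SOURCELESS SWITCHING identity
   `Σ_{R,F′,η₁} t^{|R|} t^{|F′|} w(η₁) 1[u ↔ v in R ∪ F′|_{E₁} ∪ η₁] = Z^{uv}(E₁) Z^{uv}(G)`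
   (`oddCutFM_nestedSwitching`, file 2/3: trace dictionary + ADS15 Lemma 2.2), and
   `Z^{uv}/Z^∅ = ⟨σ_uσ_v⟩^free` on `H` and on `G` by the high-temperature expansion
   (`isingCorr_free_eq_hteSum_div`, `oddCutFM_sum_tJoins_eq_hteSum`).

References: M. Aizenman, H. Duminil-Copin, V. Sidoravicius, Comm. Math. Phys. 334 (2015), Lemma 2.2
[AizenmanDuminilCopinSidoraviciusCMP2015]; M. Aizenman, Comm. Math. Phys. 86 (1982) [Aizenman1982];
G. Grimmett, S. Janson, Electron. J. Combin. 16 (2009) [GrimmettJanson2007].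
-/

noncomputable section

open Finset SimpleGraph
open scoped ENNReal symmDiff
open Literature.Probability.LatticeModels
open Summit.CriticalPhenomena.Ising3DConformalLimit.StrandShadowNegative (Rch clusterEdges)

namespace Summit.CriticalPhenomena.Ising3DConformalLimit.Theorems.StrandShadowOddCut

open scoped Classical
open Summit.CriticalPhenomena.Ising3DConformalLimit.StrandShadowNegative

/-! ## Part E. Assembly -/

section Assembly

/-- **Nested sourceless switching, closed form** (registered helper): the `T`-join switching
identity `oddCutFM_nestedSwitchingTJoin` applied to the two-current trace dictionary
`twoCurrentTraceDictionary`: for `β ≥ 0` and `u ≠ v`,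
`Σ_{R,F′,η} t^{|R|} t^{|F′|} w(η) 1[u ↔ v in R ∪ F′|_{E₁} ∪ η] = Z^{uv}(E₁) · Z^{uv}(G)`. -/
theorem oddCutFM_nestedSwitchingClosed :
    ∀ (V : Type) [Fintype V] [DecidableEq V] (G : SimpleGraph V) [DecidableRel G.Adj]
      (G₁ : SimpleGraph V) [DecidableRel G₁.Adj] (β : ℝ), 0 ≤ β → ∀ (u v : V), u ≠ v →
      ∑ F ∈ tJoins G G₁.edgeSet ∅, ∑ F' ∈ tJoins G Set.univ ∅,
          ∑ η ∈ (G.edgeFinset.filter fun e => e ∈ G₁.edgeSet).powerset,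
          (if Rch (F ∪ F'.filter (fun e => e ∈ G₁.edgeSet) ∪ η) u v then
            Real.tanh β ^ #F * Real.tanh β ^ #F' * ((Real.tanh β ^ 2) ^ #η *
              (1 - Real.tanh β ^ 2) ^ (#(G.edgeFinset.filter fun e => e ∈ G₁.edgeSet) - #η))
            else 0) =
        (∑ F ∈ tJoins G G₁.edgeSet {u, v}, Real.tanh β ^ #F) *
          ∑ F' ∈ tJoins G Set.univ {u, v}, Real.tanh β ^ #F' :=
  oddCutFM_nestedSwitchingTJoin twoCurrentTraceDictionary

/-- **The per-pair identity.** For a pairing cluster pair `(K, K′)` with holed graph `G₁` and an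
attaching pair `p = ((k,u),(k′,v))`:
`Σ_{(F,F′,η) ∈ cfg} w · 1[ku, k′v ∈ η] 1[u ↔ v in (F ∪ F′ ∪ η)|_H] = W(K,K′) · t⁴ ⟨σ_uσ_v⟩^free_H ⟨σ_uσ_v⟩^free_G`. -/
theorem oddCutFM_pair
    (hSW : ∀ (V : Type) [Fintype V] [DecidableEq V] (G : SimpleGraph V) [DecidableRel G.Adj]
      (G₁ : SimpleGraph V) [DecidableRel G₁.Adj] (β : ℝ), 0 ≤ β → ∀ (u v : V), u ≠ v →
      ∑ F ∈ tJoins G G₁.edgeSet ∅, ∑ F' ∈ tJoins G Set.univ ∅,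
          ∑ η ∈ (G.edgeFinset.filter fun e => e ∈ G₁.edgeSet).powerset,
          (if Rch (F ∪ F'.filter (fun e => e ∈ G₁.edgeSet) ∪ η) u v then
            Real.tanh β ^ #F * Real.tanh β ^ #F' * ((Real.tanh β ^ 2) ^ #η *
              (1 - Real.tanh β ^ 2) ^ (#(G.edgeFinset.filter fun e => e ∈ G₁.edgeSet) - #η))
            else 0) =
        (∑ F ∈ tJoins G G₁.edgeSet {u, v}, Real.tanh β ^ #F) *
          ∑ F' ∈ tJoins G Set.univ {u, v}, Real.tanh β ^ #F')
    {V : Type} [Fintype V] [DecidableEq V] (G : SimpleGraph V) [DecidableRel G.Adj] {β : ℝ}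
    (hβ : 0 ≤ β) (a : Fin 4 → V) (KK : Finset (Sym2 V) × Finset (Sym2 V)) (G₁ : SimpleGraph V)
    [DecidableRel G₁.Adj] (hG₁ : ∀ e, e ∈ G₁.edgeSet ↔ e ∈ G.edgeSet ∧ ∀ z ∈ e, z ∈ holedVol a KK)
    (hK : KK.1 ∈ clusterIndex G (a 0) (a 1) (a 2) (a 3))
    (hK' : KK.2 ∈ clusterIndex G (a 2) (a 3) (a 0) (a 1))
    (hdis : ∀ w, Rch KK.1 (a 0) w → ¬ Rch KK.2 (a 2) w)
    (himg : (Finset.univ.image a : Finset V) = {a 0, a 1} ∪ {a 2, a 3})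
    {p : (V × V) × (V × V)} (hp : p ∈ attachPairs G a KK) :
    ∑ x ∈ cfg G a KK, cfgWeight G β x *
        (if s(p.1.1, p.1.2) ∈ x.2.2 ∧ s(p.2.1, p.2.2) ∈ x.2.2 ∧
          Rch (medium a KK (x.1 ∪ x.2.1 ∪ x.2.2)) p.1.2 p.2.2 then 1 else 0) =
      fibreMass G β a KK * (Real.tanh β ^ 4 *
        (isingCorr G (holedVol a KK) β 0 .free {p.1.2, p.2.2} *
          isingCorr G Finset.univ β 0 .free {p.1.2, p.2.2})) := by
  obtain ⟨-, hKself, -, -, -⟩ := (mem_clusterIndex G).1 hK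
  obtain ⟨-, hK'self, -, -, -⟩ := (mem_clusterIndex G).1 hK'
  set K := KK.1 with hKdef
  set K' := KK.2 with hK'def
  have hH : ∀ z, z ∈ holedVol a KK ↔ ¬ Rch K (a 0) z ∧ ¬ Rch K' (a 2) z := fun z => by
    rw [holedVol, mem_filter]; exact ⟨fun h => h.2, fun h => ⟨mem_univ _, h⟩⟩
  have hωH : ∀ e ∈ G.edgeSet, e ∈ G₁.edgeSet ↔ ∀ z ∈ e, z ∈ holedVol a KK := fun e he => by
    rw [hG₁ e]; exact ⟨fun h => h.2, fun h => ⟨he, h⟩⟩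
  have hω : ∀ e ∈ G.edgeSet, e ∈ G₁.edgeSet ↔ ∀ z ∈ e, ¬ Rch K (a 0) z ∧ ¬ Rch K' (a 2) z :=
    fun e he => by rw [hωH e he]; exact forall₂_congr fun z _ => hH z
  /- the attaching pair -/
  rw [attachPairs, mem_filter] at hp
  obtain ⟨-, hk, huH, hku, hk', hvH, hk'v, huv⟩ := hp
  have hkH : p.1.1 ∉ holedVol a KK := fun h => ((hH _).1 h).1 hk
  have hk'H : p.2.1 ∉ holedVol a KK := fun h => ((hH _).1 h).2 hk'
  have huvH : ({p.1.2, p.2.2} : Finset V) ⊆ holedVol a KK := by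
    intro z hz
    simp only [mem_insert, mem_singleton] at hz
    rcases hz with rfl | rfl
    exacts [huH, hvH]
  -- the switching identity for this pair (before abbreviating `E₁`)
  have hsw := hSW V G G₁ β hβ _ _ huv
  set E₁ : Finset (Sym2 V) := G.edgeFinset.filter (fun e => e ∈ G₁.edgeSet) with hE₁def
  have hE₁E : E₁ ⊆ G.edgeFinset := filter_subset _ _
  have hmemE₁ : ∀ e, e ∈ E₁ ↔ e ∈ G.edgeSet ∧ ∀ z ∈ e, z ∈ holedVol a KK := fun e => by
    rw [hE₁def, mem_filter, SimpleGraph.mem_edgeFinset, hG₁]; tauto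
  have he₁ : s(p.1.1, p.1.2) ∈ G.edgeFinset \ E₁ :=
    mem_sdiff.2 ⟨SimpleGraph.mem_edgeFinset.2 hku,
      fun h => hkH (((hmemE₁ _).1 h).2 _ (Sym2.mem_mk_left _ _))⟩
  have he₂ : s(p.2.1, p.2.2) ∈ G.edgeFinset \ E₁ :=
    mem_sdiff.2 ⟨SimpleGraph.mem_edgeFinset.2 hk'v,
      fun h => hk'H (((hmemE₁ _).1 h).2 _ (Sym2.mem_mk_left _ _))⟩
  have hne : s(p.1.1, p.1.2) ≠ s(p.2.1, p.2.2) := by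
    intro h
    rw [Sym2.eq_iff] at h
    rcases h with ⟨-, h⟩ | ⟨h, -⟩
    · exact huv h
    · exact hkH (h ▸ hvH)
  /- Step A: the configuration sum over the fibre as a sum over even subgraphs of the hole -/
  have hfib : fibre G a KK = (tJoins G Set.univ ({a 0, a 1} ∪ {a 2, a 3})).filter
      (fun F => clusterEdges F (a 0) = K ∧ clusterEdges F (a 2) = K') := by
    rw [fibre, himg]
  have hcfg : ∀ φ : Finset (Sym2 V) × Finset (Sym2 V) × Finset (Sym2 V) → ℝ,
      ∑ x ∈ cfg G a KK, φ x = ∑ R ∈ tJoins G G₁.edgeSet ∅, ∑ F' ∈ tJoins G Set.univ ∅,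
        ∑ η ∈ G.edgeFinset.powerset, φ (K ∪ K' ∪ R, F', η) := by
    intro φ
    rw [cfg, Finset.sum_product, hfib, oddCutFM_twoCluster_sum G hK hK' hdis hω]
    refine Finset.sum_congr rfl fun R _ => ?_
    rw [Finset.sum_product]
  have hRav : ∀ R ∈ tJoins G G₁.edgeSet ∅, ∀ e ∈ R, ∀ z ∈ e, ¬ Rch K (a 0) z ∧ ¬ Rch K' (a 2) z :=
    fun R hR e he => (hω e (SimpleGraph.mem_edgeFinset.1 (((mem_tJoins G).1 hR).1 he))).1
      (((mem_tJoins G).1 hR).2.1 (mem_coe.2 he))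
  have hdisjR : ∀ R ∈ tJoins G G₁.edgeSet ∅, Disjoint (K ∪ K') R := fun R hR =>
    disjoint_union_left.2 ⟨disjoint_of_avoid hKself fun e he z hz => (hRav R hR e he z hz).1,
      disjoint_of_avoid hK'self fun e he z hz => (hRav R hR e he z hz).2⟩
  /- Step B: the fibre mass `W = t^{|K ∪ K′|} Z∅(E₁) Z∅(G)` -/
  have hbinE : ∑ η ∈ G.edgeFinset.powerset, etaWeight G (Real.tanh β) η = 1 := by
    unfold etaWeight
    rw [Finset.sum_pow_mul_eq_add_pow, add_sub_cancel, one_pow]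
  have hfm : fibreMass G β a KK = Real.tanh β ^ #(K ∪ K') *
      (∑ R ∈ tJoins G G₁.edgeSet ∅, Real.tanh β ^ #R) *
        ∑ F' ∈ tJoins G Set.univ ∅, Real.tanh β ^ #F' := by
    rw [fibreMass, hcfg]
    dsimp only [cfgWeight]
    have step : ∀ R ∈ tJoins G G₁.edgeSet ∅, ∀ F' ∈ tJoins G Set.univ ∅,
        ∑ η ∈ G.edgeFinset.powerset, Real.tanh β ^ #(K ∪ K' ∪ R) * Real.tanh β ^ #F' *
          etaWeight G (Real.tanh β) η =
          Real.tanh β ^ #(K ∪ K') * Real.tanh β ^ #R * Real.tanh β ^ #F' := fun R hR F' _ => by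
      rw [← Finset.mul_sum, hbinE, mul_one, card_union_of_disjoint (hdisjR R hR), pow_add]
    rw [Finset.sum_congr rfl fun R hR => Finset.sum_congr rfl fun F' hF' => step R hR F' hF']
    simp only [Finset.mul_sum, Finset.sum_mul]
    exact Finset.sum_comm
  /- Step C: the `η`-sum for fixed `R`, `F′` -/
  have hinner : ∀ R ∈ tJoins G G₁.edgeSet ∅, ∀ F' ∈ tJoins G Set.univ ∅,
      ∑ η ∈ G.edgeFinset.powerset, Real.tanh β ^ #(K ∪ K' ∪ R) * Real.tanh β ^ #F' *
        etaWeight G (Real.tanh β) η * (if s(p.1.1, p.1.2) ∈ η ∧ s(p.2.1, p.2.2) ∈ η ∧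
          Rch (medium a KK (K ∪ K' ∪ R ∪ F' ∪ η)) p.1.2 p.2.2 then 1 else 0) =
      Real.tanh β ^ #(K ∪ K') * Real.tanh β ^ 4 * ∑ η₁ ∈ E₁.powerset,
        (if Rch (R ∪ F'.filter (fun e => e ∈ G₁.edgeSet) ∪ η₁) p.1.2 p.2.2 then
          Real.tanh β ^ #R * Real.tanh β ^ #F' *
            ((Real.tanh β ^ 2) ^ #η₁ * (1 - Real.tanh β ^ 2) ^ (#E₁ - #η₁)) else 0) := by
    intro R hR F' hF'
    have hRω : (↑R : Set (Sym2 V)) ⊆ G₁.edgeSet := ((mem_tJoins G).1 hR).2.1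
    have hF'G : F' ⊆ G.edgeFinset := ((mem_tJoins G).1 hF').1
    -- the medium of `K ∪ K′ ∪ R ∪ F′ ∪ (η₁ ∪ η₂)` is `R ∪ F′|_{E₁} ∪ η₁`
    have hPQ : ∀ η₁, η₁ ⊆ E₁ → ∀ η₂, η₂ ⊆ G.edgeFinset \ E₁ →
        (Rch (medium a KK (K ∪ K' ∪ R ∪ F' ∪ (η₁ ∪ η₂))) p.1.2 p.2.2 ↔
          Rch (R ∪ F'.filter (fun e => e ∈ G₁.edgeSet) ∪ η₁) p.1.2 p.2.2) := by
      intro η₁ hη₁ η₂ hη₂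
      suffices hmed : medium a KK (K ∪ K' ∪ R ∪ F' ∪ (η₁ ∪ η₂)) =
          R ∪ F'.filter (fun e => e ∈ G₁.edgeSet) ∪ η₁ by rw [hmed]
      rw [medium, filter_union, filter_union, filter_union, filter_union, filter_union]
      have h1 : K.filter (fun e => ∀ x ∈ e, x ∈ holedVol a KK) = ∅ := by
        refine filter_eq_empty_iff.2 fun e he hin => ?_
        have hz := Sym2.out_fst_mem e
        exact ((hH _).1 (hin _ hz)).1 (rch_of_mem_of_self hKself he hz)
      have h1' : K'.filter (fun e => ∀ x ∈ e, x ∈ holedVol a KK) = ∅ := by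
        refine filter_eq_empty_iff.2 fun e he hin => ?_
        have hz := Sym2.out_fst_mem e
        exact ((hH _).1 (hin _ hz)).2 (rch_of_mem_of_self hK'self he hz)
      have h2 : R.filter (fun e => ∀ x ∈ e, x ∈ holedVol a KK) = R :=
        filter_eq_self.2 fun e he => ((hG₁ e).1 (hRω (mem_coe.2 he))).2
      have h3 : F'.filter (fun e => ∀ x ∈ e, x ∈ holedVol a KK) =
          F'.filter (fun e => e ∈ G₁.edgeSet) :=
        filter_congr fun e he => (hωH e (SimpleGraph.mem_edgeFinset.1 (hF'G he))).symm
      have h4 : η₁.filter (fun e => ∀ x ∈ e, x ∈ holedVol a KK) = η₁ :=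
        filter_eq_self.2 fun e he => ((hmemE₁ e).1 (hη₁ he)).2
      have h5 : η₂.filter (fun e => ∀ x ∈ e, x ∈ holedVol a KK) = ∅ :=
        filter_eq_empty_iff.2 fun e he hin => (mem_sdiff.1 (hη₂ he)).2
          ((hmemE₁ e).2 ⟨SimpleGraph.mem_edgeFinset.1 (mem_sdiff.1 (hη₂ he)).1, hin⟩)
      rw [h1, h1', h2, h3, h4, h5]
      simp only [empty_union, union_empty]
    have key := oddCutFM_eta_sum hE₁E he₁ he₂ hne
      (fun η => Rch (medium a KK (K ∪ K' ∪ R ∪ F' ∪ η)) p.1.2 p.2.2)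
      (fun η₁ => Rch (R ∪ F'.filter (fun e => e ∈ G₁.edgeSet) ∪ η₁) p.1.2 p.2.2) hPQ
      (Real.tanh β ^ 2) (1 - Real.tanh β ^ 2) (add_sub_cancel _ _)
    simp only [etaWeight, mul_assoc] at key ⊢
    rw [← Finset.mul_sum, ← Finset.mul_sum, key, card_union_of_disjoint (hdisjR R hR)]
    simp only [Finset.mul_sum]
    refine Finset.sum_congr rfl fun η₁ _ => ?_
    split_ifs <;> ring
  /- Step D: assemble -/
  have hZ : ∀ A : Finset V, A ⊆ holedVol a KK →
      ∑ F ∈ tJoins G G₁.edgeSet A, Real.tanh β ^ #F = hteSum G (holedVol a KK) (Real.tanh β) A :=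
    fun A hA => oddCutFM_sum_tJoins_eq_hteSum G hωH hA _
  have hZu : ∀ A : Finset V,
      ∑ F ∈ tJoins G Set.univ A, Real.tanh β ^ #F = hteSum G Finset.univ (Real.tanh β) A :=
    fun A => oddCutFM_sum_tJoins_eq_hteSum G (fun e _ => by simp) (subset_univ A) _
  have hH0 : hteSum G (holedVol a KK) (Real.tanh β) ∅ ≠ 0 := (hteSum_empty_pos G _ β).ne'
  have hU0 : hteSum G Finset.univ (Real.tanh β) ∅ ≠ 0 := (hteSum_empty_pos G Finset.univ β).ne'
  rw [hcfg]
  dsimp only [cfgWeight]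
  rw [Finset.sum_congr rfl fun R hR => Finset.sum_congr rfl fun F' hF' => hinner R hR F' hF']
  simp only [← Finset.mul_sum]
  rw [hsw, hfm, hZ ∅ (empty_subset _), hZ _ huvH, hZu, hZu,
    isingCorr_free_eq_hteSum_div G _ β huvH,
    isingCorr_free_eq_hteSum_div G Finset.univ β (subset_univ _)]
  set x := hteSum G (holedVol a KK) (Real.tanh β) {p.1.2, p.2.2}
  set y := hteSum G Finset.univ (Real.tanh β) {p.1.2, p.2.2}
  set x₀ := hteSum G (holedVol a KK) (Real.tanh β) ∅
  set y₀ := hteSum G Finset.univ (Real.tanh β) ∅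
  rw [div_mul_div_comm, mul_div_assoc', mul_div_assoc', eq_div_iff (mul_ne_zero hH0 hU0)]
  ring

/-- **The first-moment identity from the nested sourceless switching identity** (closed form
`oddCutFM_nestedSwitchingClosed`; equivalently `oddCutFM_nestedSwitchingTJoin` applied to the
two-current trace dictionary `twoCurrentTraceDictionary`). -/
theorem oddCutFM_of_switching
    (hSW : ∀ (V : Type) [Fintype V] [DecidableEq V] (G : SimpleGraph V) [DecidableRel G.Adj]
      (G₁ : SimpleGraph V) [DecidableRel G₁.Adj] (β : ℝ), 0 ≤ β → ∀ (u v : V), u ≠ v →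
      ∑ F ∈ tJoins G G₁.edgeSet ∅, ∑ F' ∈ tJoins G Set.univ ∅,
          ∑ η ∈ (G.edgeFinset.filter fun e => e ∈ G₁.edgeSet).powerset,
          (if Rch (F ∪ F'.filter (fun e => e ∈ G₁.edgeSet) ∪ η) u v then
            Real.tanh β ^ #F * Real.tanh β ^ #F' * ((Real.tanh β ^ 2) ^ #η *
              (1 - Real.tanh β ^ 2) ^ (#(G.edgeFinset.filter fun e => e ∈ G₁.edgeSet) - #η))
            else 0) =
        (∑ F ∈ tJoins G G₁.edgeSet {u, v}, Real.tanh β ^ #F) *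
          ∑ F' ∈ tJoins G Set.univ {u, v}, Real.tanh β ^ #F') :
    ∀ (V : Type) [Fintype V] [DecidableEq V] (G : SimpleGraph V) [DecidableRel G.Adj] (β : ℝ),
      0 ≤ β → ∀ a : Fin 4 → V, Function.Injective a →
      ∀ KK ∈ pairIdx G a, bridgeMoment G 1 β a KK = fibreMass G β a KK * firstMom G β a KK := by
  intro V _ _ G _ β hβ a _ KK hKK
  /- Step 0: the cluster pair `(K, K′)` -/
  obtain ⟨F₀, hF₀, hF₀KK⟩ := Finset.mem_image.1 hKK
  rw [pairingSet, mem_filter] at hF₀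
  obtain ⟨hF₀T, hF₀2, hF₀3⟩ := hF₀
  set K := KK.1 with hKdef
  set K' := KK.2 with hK'def
  have hKF : clusterEdges F₀ (a 0) = K := by rw [hKdef, ← hF₀KK]
  have hK'F : clusterEdges F₀ (a 2) = K' := by rw [hK'def, ← hF₀KK]
  have himg : (Finset.univ.image a : Finset V) = {a 0, a 1} ∪ {a 2, a 3} := by
    ext w
    simp only [Finset.mem_image, Finset.mem_univ, true_and, Finset.mem_union, Finset.mem_insert,
      Finset.mem_singleton]
    constructor
    · rintro ⟨i, rfl⟩
      fin_cases i <;> simp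
    · rintro ((rfl | rfl) | (rfl | rfl)) <;> exact ⟨_, rfl⟩
  have hmem : ∀ w, w ∈ (Finset.univ.image a : Finset V) ↔ w = a 0 ∨ w = a 1 ∨ w = a 2 ∨ w = a 3 := by
    intro w; rw [himg]; simp only [mem_union, mem_insert, mem_singleton, or_assoc]
  have ha0 : a 0 ∈ (Finset.univ.image a : Finset V) := (hmem _).2 (Or.inl rfl)
  have ha1 : a 1 ∈ (Finset.univ.image a : Finset V) := (hmem _).2 (Or.inr (Or.inl rfl))
  have ha2 : a 2 ∈ (Finset.univ.image a : Finset V) := (hmem _).2 (Or.inr (Or.inr (Or.inl rfl)))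
  have ha3 : a 3 ∈ (Finset.univ.image a : Finset V) := (hmem _).2 (Or.inr (Or.inr (Or.inr rfl)))
  have hreach : ∀ w ∈ (Finset.univ.image a : Finset V), Rch F₀ (a 0) w → w = a 0 ∨ w = a 1 := by
    intro w hw hr
    rcases (hmem w).1 hw with rfl | rfl | rfl | rfl
    exacts [Or.inl rfl, Or.inr rfl, absurd hr hF₀2, absurd hr hF₀3]
  have h01 : Rch F₀ (a 0) (a 1) := rch_a1 G ha0 hreach hF₀T
  have hK : K ∈ clusterIndex G (a 0) (a 1) (a 2) (a 3) := hKF ▸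
    clusterEdges_mem_clusterIndex G ha0 ha1 (fun w hw h0 h1 => by
      rcases (hmem w).1 hw with rfl | rfl | rfl | rfl
      exacts [absurd rfl h0, absurd rfl h1, Or.inl rfl, Or.inr rfl]) hF₀T hF₀2 hF₀3
  have hK' : K' ∈ clusterIndex G (a 2) (a 3) (a 0) (a 1) := hK'F ▸
    clusterEdges_mem_clusterIndex G ha2 ha3 (fun w hw h2 h3 => by
      rcases (hmem w).1 hw with rfl | rfl | rfl | rfl
      exacts [Or.inl rfl, Or.inr rfl, absurd rfl h2, absurd rfl h3]) hF₀T
      (fun h => hF₀2 h.symm) (fun h => hF₀2 (h01.trans h.symm))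
  have hdis : ∀ w, Rch K (a 0) w → ¬ Rch K' (a 2) w := by
    intro w h1 h2
    rw [← hKF, rch_clusterEdges_iff] at h1
    rw [← hK'F, rch_clusterEdges_iff] at h2
    exact hF₀2 (h1.trans h2.symm)
  /- Step 1: the holed graph `G₁` (edges of `G` inside the holed volume) -/
  set G₁ : SimpleGraph V :=
    SimpleGraph.fromEdgeSet {e | e ∈ G.edgeSet ∧ ∀ z ∈ e, z ∈ holedVol a KK} with hG₁def
  letI : DecidableRel G₁.Adj := Classical.decRel _
  have hG₁ : ∀ e, e ∈ G₁.edgeSet ↔ e ∈ G.edgeSet ∧ ∀ z ∈ e, z ∈ holedVol a KK := by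
    intro e
    rw [hG₁def, SimpleGraph.edgeSet_fromEdgeSet]
    simp only [Set.mem_sdiff, Set.mem_setOf_eq]
    exact ⟨fun h => h.1, fun h => ⟨h, G.not_isDiag_of_mem_edgeSet h.1⟩⟩
  /- Step 2: both sides as sums over the attaching pairs; conclude pair by pair -/
  have hLHS : bridgeMoment G 1 β a KK = ∑ p ∈ attachPairs G a KK, ∑ x ∈ cfg G a KK,
      cfgWeight G β x * (if s(p.1.1, p.1.2) ∈ x.2.2 ∧ s(p.2.1, p.2.2) ∈ x.2.2 ∧
        Rch (medium a KK (x.1 ∪ x.2.1 ∪ x.2.2)) p.1.2 p.2.2 then 1 else 0) := by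
    unfold bridgeMoment bridges
    simp_rw [pow_one, natCast_card_filter, Finset.mul_sum]
    exact Finset.sum_comm
  rw [hLHS, firstMom, Finset.mul_sum, Finset.mul_sum]
  exact Finset.sum_congr rfl fun p hp => oddCutFM_pair hSW G hβ a KK G₁ hG₁ hK hK' hdis himg hp

end Assembly

/-- **stub_oddClusterCutFirstMoment** (finite graph; the dimension-free heart of the line).
For every pairing cluster pair `(K, K′)`:
`M₁(K,K′) = W(K,K′) · t⁴ Σ_{((k,u),(k′,v))} ⟨σ_uσ_v⟩^free_H ⟨σ_uσ_v⟩^free_G`.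
Proof: `oddCutFM_of_switching` (two-cluster fibre bijection `F ↦ F ∖ (K ∪ K′)` onto the even
subgraphs of the holed graph; the two attaching bonds lie outside `E(H)`, so the product weight of
`η` factorises and the two sprinkles cost `t⁴`; NESTED SOURCELESS SWITCHING, ADS15 Lemma 2.2 with
the first current on `E(H)`, `A = B = ∅`, sources `{u,v}` switched into both currents:
`Σ_{R ∈ 𝒯_∅(E(H)), F′ ∈ 𝒯_∅(G), η_H} t^{|R|+|F′|} w(η_H) 1[u ↔ v in R ∪ F′|_{E(H)} ∪ η_H]
 = Z^{uv}(E(H)) Z^{uv}(G) = Z∅(E(H)) Z∅(G) ⟨σ_uσ_v⟩^free_H ⟨σ_uσ_v⟩^free_G`, the connection read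
INSIDE `H`) applied to the closed switching identity `oddCutFM_nestedSwitchingClosed` (the
two-current trace dictionary `twoCurrentTraceDictionary`, then the switch).
Refs: Aizenman–Duminil-Copin–Sidoravicius, CMP 334 (2015) Lemma 2.2 (arXiv:1311.1937);
Grimmett–Janson 2009 (even subgraphs); Aizenman 1982. -/
theorem stub_oddClusterCutFirstMoment :
    ∀ (V : Type) [Fintype V] [DecidableEq V] (G : SimpleGraph V) [DecidableRel G.Adj] (β : ℝ),
      0 ≤ β → ∀ a : Fin 4 → V, Function.Injective a →
      ∀ KK ∈ pairIdx G a, bridgeMoment G 1 β a KK = fibreMass G β a KK * firstMom G β a KK := by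
  exact oddCutFM_of_switching oddCutFM_nestedSwitchingClosed

end Summit.CriticalPhenomena.Ising3DConformalLimit.Theorems.StrandShadowOddCut

end
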